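import Summits.AnomalousDissipation.AnomalousDissipation.Theorems.SawtoothPulseCascadeK1LocalisedCascadeLedgerThinRelease
import Summits.AnomalousDissipation.AnomalousDissipation.Theorems.SawtoothPulseCascadeK1LocalisedCascadeFarModes

/-!
# K1loc, line `Spectral` / thin start — helper: FOUR-CHANNEL SPLIT OF THE START SYMBOL, FAR CHANNELS DISCHARGED, «FREQUENTLY» DOORS

Helper file of the prover lane on the crux `K1LocalisedCascade` (stmt-AnomalousDissipation-19491), route
`SawtoothPulseCascade` (S-B/S-C assembly seat; S-B ↔ S-D interface).  The thin closer
`…LedgerThinClose.k1Localised_of_thin_iterate_bound` asks for ONE bound `√(Σ μ_n²|𝓕a_n|²) ≤ q < ‖datum‖` on the tracked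
start energy of the explicit inviscid iterates `a_n`, `μ_n = 1 − g_rad·(1 − g_cone)·g_env` the start symbol with thin
tracked radius `L = c(γ²−3)^n` and envelope `R_n = 2c(γ²−3)^n(Γ/ρ₀)^n`.  Here that hypothesis is split WITHOUT LOSS OF A
CONSTANT: since `μ_n² ≤ 1` everywhere and `μ_n = 0` on the released core (`…ThinRelease.symProdS_eq_zero_of_released`),
`μ_n(k)² ≤ [|k₀| < (1+1/250)L] + [(1+1/250)L ≤ |k₀| ∧ 13/10·|k₀| < γ|k₁|] + [R_n ≤ |k₀|] + [R_n ≤ |k₁|]`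
(`symProdS_sq_le_four_indicators`; compare the factor `3` of `…ThinChannels`).  The two FAR channels of the inviscid
iterates are discharged here once and for all: `|∂_j a_n| ≤ 2π(1+γ)^{2n}` (`…IterateGradient`) and
`Σ'[R ≤ |k_j|]‖𝓕θ‖² ≤ (D/(2πR))²` (`…FarModes`) give `Σ'[R_n ≤ |k_j|]‖𝓕a_n‖² ≤ ((1+γ)^{2n}/R_n)² = (1/(2c))²·ϑ^{2n}`,
`ϑ = (1+γ)²ρ₀/((γ²−3)Γ) < 1` because `(1+γ)² < 2(γ²−3)` for `γ ≥ 5` (`tsum_far_iterate_le`, `farRate_lt_one`,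
`eventually_far_iterate_le`).  Also the «frequently» doors of the thin closers (`k1Localised_of_thin_firstGoodPiece_frequently`,
`k1Localised_of_thin_iterate_bound_frequently`): the closer needs ONE start phase beyond its thresholds, so the socket / the
iterate bound is only needed for infinitely many `n`.  The consequence — `K1Localised P (γ²−3)` from a bound on
`LowBand_n + HighOffCone_n` alone — is `…LedgerThinTarget`.  No definitions; nothing about the crux at `δ₀ = ¼`.
[cite: DEIJ2022, (1.2)–(1.3)] [cite: ElgindiLissMattingly2025, §1.2.2 and §3.1] [cite: Grafakos2014, Prop. 3.2.6 (8) and Prop. 3.2.7 (3)]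
[problem: turb]
-/

-- `Summit.<Summit>.<Problem>`: single-conjunct summit, the duplicate namespace segment is deliberate.
set_option linter.dupNamespace false

noncomputable section

namespace Summit.AnomalousDissipation.AnomalousDissipation.Theorems.SawtoothPulseCascade.K1Ledger.From

open MeasureTheory Set Filter Topology UnitAddTorus Function
open scoped ENNReal
open Literature.Analysis Literature.Analysis.FunctionSpaces Literature.Analysis.FunctionSpaces.Torus Literature.Analysis.FluidPDE
open Literature.Analysis.FluidPDE.ShearStage
open Literature.Analysis.FluidPDE.SawtoothCascade Literature.Analysis.FluidPDE.SawtoothCascade.CascadeParams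
open Summit.AnomalousDissipation.AnomalousDissipation.Theorems.SawtoothPulseCascade.K1Symbol
open Summit.AnomalousDissipation.AnomalousDissipation.Theorems.SawtoothPulseCascade.K1Start
open Summit.AnomalousDissipation.AnomalousDissipation.Theorems.SawtoothPulseCascade.K1Ledger

/-! ## §1 The thin start symbol against four indicators (no constant lost) -/

/-- **The square of the thin start symbol is dominated by four channel indicators**: for `L, w > 0`,
`μ(k)² ≤ [|k₀| < (1+1/250)L] + [(1+1/250)L ≤ |k₀| ∧ 13/10·|k₀| < γ|k₁|] + ([R ≤ |k₀|] + [R ≤ |k₁|])`, where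
`μ = 1 − sT((|k₀|−L)/(L/250))·(1 − sT((γ|k₁| − 13/10·|k₀|)/(L/20)))·((1−sT((|k₀|−R)/w))(1−sT((|k₁|−R)/w)))`:
`|μ| ≤ 1` everywhere and `μ = 0` on the released core. [cite: ElgindiLissMattingly2025, §1.2.2 (the unstable cone)] -/
theorem symProdS_sq_le_four_indicators (γ : ℝ) {L R w : ℝ} (hL : 0 < L) (hw : 0 < w) (kh kv : ℤ) :
    (1 - Real.smoothTransition ((|(kh : ℝ)| - L) / (1 / 250 * L)) *
        (1 - Real.smoothTransition ((γ * |(kv : ℝ)| - 13 / 10 * |(kh : ℝ)|) / (1 / 20 * L))) *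
      ((1 - Real.smoothTransition ((|(kh : ℝ)| - R) / w)) * (1 - Real.smoothTransition ((|(kv : ℝ)| - R) / w)))) ^ 2 ≤
      (if |(kh : ℝ)| < (1 + 1 / 250) * L then (1 : ℝ) else 0) +
        (if (1 + 1 / 250) * L ≤ |(kh : ℝ)| ∧ 13 / 10 * |(kh : ℝ)| < γ * |(kv : ℝ)| then (1 : ℝ) else 0) +
        ((if R ≤ |(kh : ℝ)| then (1 : ℝ) else 0) + (if R ≤ |(kv : ℝ)| then (1 : ℝ) else 0)) := by
  have h1 : (1 - Real.smoothTransition ((|(kh : ℝ)| - L) / (1 / 250 * L)) *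
        (1 - Real.smoothTransition ((γ * |(kv : ℝ)| - 13 / 10 * |(kh : ℝ)|) / (1 / 20 * L))) *
      ((1 - Real.smoothTransition ((|(kh : ℝ)| - R) / w)) * (1 - Real.smoothTransition ((|(kv : ℝ)| - R) / w)))) ^ 2 ≤ 1 := by
    have h := abs_symProdS_le_one γ (1 / 250) (1 / 20) (13 / 10) L R w kh kv
    rw [← sq_abs]
    nlinarith [abs_nonneg (1 - Real.smoothTransition ((|(kh : ℝ)| - L) / (1 / 250 * L)) *
        (1 - Real.smoothTransition ((γ * |(kv : ℝ)| - 13 / 10 * |(kh : ℝ)|) / (1 / 20 * L))) *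
      ((1 - Real.smoothTransition ((|(kh : ℝ)| - R) / w)) * (1 - Real.smoothTransition ((|(kv : ℝ)| - R) / w))))]
  have hI : ∀ (p : Prop) [Decidable p], (0 : ℝ) ≤ (if p then (1 : ℝ) else 0) := fun p _ => by split_ifs <;> norm_num
  by_cases hA : |(kh : ℝ)| < (1 + 1 / 250) * L
  · rw [if_pos hA]
    linarith [hI ((1 + 1 / 250) * L ≤ |(kh : ℝ)| ∧ 13 / 10 * |(kh : ℝ)| < γ * |(kv : ℝ)|), hI (R ≤ |(kh : ℝ)|),
      hI (R ≤ |(kv : ℝ)|)]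
  rw [if_neg hA]
  have hA' : (1 + 1 / 250) * L ≤ |(kh : ℝ)| := le_of_not_gt hA
  by_cases hB : 13 / 10 * |(kh : ℝ)| < γ * |(kv : ℝ)|
  · rw [if_pos ⟨hA', hB⟩]
    linarith [hI (R ≤ |(kh : ℝ)|), hI (R ≤ |(kv : ℝ)|)]
  rw [if_neg (fun h => hB h.2)]
  by_cases hC : R ≤ |(kh : ℝ)|
  · rw [if_pos hC]; linarith [hI (R ≤ |(kv : ℝ)|)]
  by_cases hD : R ≤ |(kv : ℝ)|
  · rw [if_neg hC, if_pos hD]; linarith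
  rw [if_neg hC, if_neg hD, symProdS_eq_zero_of_released hL hw hA' (le_of_not_gt hB) (le_of_not_ge hC) (le_of_not_ge hD)]
  norm_num

/-- **The tracked start energy splits into the low band, the high off-cone channel and the two far channels** (no constant
lost): for non-negative summable `c` (e.g. `c(k) = ‖𝓕v(k)‖²`),
`Σ' μ(k)²c(k) ≤ Σ'[|k₀| < (1+1/250)L]c + Σ'[(1+1/250)L ≤ |k₀| ∧ 13/10·|k₀| < γ|k₁|]c + (Σ'[R ≤ |k₀|]c + Σ'[R ≤ |k₁|]c)`.
[cite: ElgindiLissMattingly2025, §1.2.2 (the unstable cone)] -/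
theorem tsum_symProdS_sq_le_four_channels (γ : ℝ) {L R w : ℝ} (hL : 0 < L) (hw : 0 < w) {c : (Fin 2 → ℤ) → ℝ}
    (hc : Summable c) (hc0 : ∀ k, 0 ≤ c k) :
    ∑' k : Fin 2 → ℤ, (1 - Real.smoothTransition ((|((k 0 : ℤ) : ℝ)| - L) / (1 / 250 * L)) *
        (1 - Real.smoothTransition ((γ * |((k 1 : ℤ) : ℝ)| - 13 / 10 * |((k 0 : ℤ) : ℝ)|) / (1 / 20 * L))) *
        ((1 - Real.smoothTransition ((|((k 0 : ℤ) : ℝ)| - R) / w)) *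
          (1 - Real.smoothTransition ((|((k 1 : ℤ) : ℝ)| - R) / w)))) ^ 2 * c k ≤
      ∑' k : Fin 2 → ℤ, (if |((k 0 : ℤ) : ℝ)| < (1 + 1 / 250) * L then (1 : ℝ) else 0) * c k +
        ∑' k : Fin 2 → ℤ, (if (1 + 1 / 250) * L ≤ |((k 0 : ℤ) : ℝ)| ∧ 13 / 10 * |((k 0 : ℤ) : ℝ)| < γ * |((k 1 : ℤ) : ℝ)|
          then (1 : ℝ) else 0) * c k +
        (∑' k : Fin 2 → ℤ, (if R ≤ |((k 0 : ℤ) : ℝ)| then (1 : ℝ) else 0) * c k +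
          ∑' k : Fin 2 → ℤ, (if R ≤ |((k 1 : ℤ) : ℝ)| then (1 : ℝ) else 0) * c k) := by
  have hsI : ∀ (p : (Fin 2 → ℤ) → Prop) [DecidablePred p], Summable fun k => (if p k then (1 : ℝ) else 0) * c k := by
    intro p _
    refine Summable.of_nonneg_of_le (fun k => mul_nonneg (by split_ifs <;> norm_num) (hc0 k)) (fun k => ?_) hc
    split_ifs <;> simp [hc0 k]
  have hle := fun k : Fin 2 → ℤ =>
    mul_le_mul_of_nonneg_right (symProdS_sq_le_four_indicators γ hL hw (R := R) (k 0) (k 1)) (hc0 k)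
  have h1 := hsI (fun k => |((k 0 : ℤ) : ℝ)| < (1 + 1 / 250) * L)
  have h2 := hsI (fun k => (1 + 1 / 250) * L ≤ |((k 0 : ℤ) : ℝ)| ∧ 13 / 10 * |((k 0 : ℤ) : ℝ)| < γ * |((k 1 : ℤ) : ℝ)|)
  have h3 := hsI (fun k => R ≤ |((k 0 : ℤ) : ℝ)|)
  have h4 := hsI (fun k => R ≤ |((k 1 : ℤ) : ℝ)|)
  have hR := (h1.add h2).add (h3.add h4)
  have hL' : Summable fun k : Fin 2 → ℤ => (1 - Real.smoothTransition ((|((k 0 : ℤ) : ℝ)| - L) / (1 / 250 * L)) *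
        (1 - Real.smoothTransition ((γ * |((k 1 : ℤ) : ℝ)| - 13 / 10 * |((k 0 : ℤ) : ℝ)|) / (1 / 20 * L))) *
        ((1 - Real.smoothTransition ((|((k 0 : ℤ) : ℝ)| - R) / w)) *
          (1 - Real.smoothTransition ((|((k 1 : ℤ) : ℝ)| - R) / w)))) ^ 2 * c k := by
    refine Summable.of_nonneg_of_le (fun k => mul_nonneg (sq_nonneg _) (hc0 k)) (fun k => (hle k).trans_eq ?_) hR
    ring
  rw [← h1.tsum_add h2, ← h3.tsum_add h4, ← (h1.add h2).tsum_add (h3.add h4)]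
  refine Summable.tsum_le_tsum (fun k => (hle k).trans_eq ?_) hL' hR
  ring

/-! ## §2 The far channels of the inviscid iterates vanish -/

/-- **The far rate is below one**: `(1+γ)²·ρ₀ < (γ²−3)·((1+γ)²+1)` for `5 ≤ γ`, `L_min ≥ 1000` — since `ρ₀ ≤ (γ²−3) + ½`
and `(1+γ)² < 2(γ²−3)`. [folklore] -/
theorem farRate_lt_one {γ Lm : ℝ} (hγ : 5 ≤ γ) (hLm : 1000 ≤ Lm) :
    (1 + γ) ^ 2 * ((γ ^ 2 - 5 / 2) / (1 + 1 / 250) ^ 2 - 1 / (2 * (1 + 1 / 250) * Lm)) /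
        ((γ ^ 2 - 3) * ((1 + γ) ^ 2 + 1)) < 1 := by
  have hρ := rho_le_rate_add_half (γ := γ) hγ hLm
  have hr0 : 0 < γ ^ 2 - 3 := by nlinarith
  rw [div_lt_one (by positivity)]
  have h2 : (1 + γ) ^ 2 < 2 * (γ ^ 2 - 3) := by nlinarith
  have h3 : 0 < (1 + γ) ^ 2 := by positivity
  calc (1 + γ) ^ 2 * ((γ ^ 2 - 5 / 2) / (1 + 1 / 250) ^ 2 - 1 / (2 * (1 + 1 / 250) * Lm))
      ≤ (1 + γ) ^ 2 * (γ ^ 2 - 3 + 1 / 2) := mul_le_mul_of_nonneg_left hρ h3.le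
    _ = (γ ^ 2 - 3) * (1 + γ) ^ 2 + (1 + γ) ^ 2 / 2 := by ring
    _ < (γ ^ 2 - 3) * (1 + γ) ^ 2 + (γ ^ 2 - 3) := by linarith
    _ = (γ ^ 2 - 3) * ((1 + γ) ^ 2 + 1) := by ring

/-- **The far ratio along the thin schedule**: `(1+γ)^{2n}/R_n = (1/(2c))·ϑⁿ` with `R_n = 2(c rⁿ/ρ₀ⁿ)Γⁿ` and
`ϑ = (1+γ)²ρ₀/(rΓ)`. [folklore] -/
theorem farRatio_eq {γ c r ρ Γ : ℝ} (hc : c ≠ 0) (hr : r ≠ 0) (hρ : ρ ≠ 0) (hΓ : Γ ≠ 0) (n : ℕ) :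
    (1 + γ) ^ (2 * n) / (2 * (c * r ^ n / ρ ^ n) * Γ ^ n) = 1 / (2 * c) * ((1 + γ) ^ 2 * ρ / (r * Γ)) ^ n := by
  rw [pow_mul, div_pow, mul_pow, mul_pow]
  field_simp

section Cascade

variable (P : CascadeParams)

/-- **The far channels of the inviscid iterate**: for the inviscid iterate `(a, b)` of the datum (`γ ≥ 0`) and any `R > 0`,
`Σ' [R ≤ |k_j|]·‖𝓕a_n(k)‖² ≤ ((1+γ)^{2n}/R)²` for both axes `j` (`|∂_j a_n| ≤ 2π(1+γ)^{2n}` and Parseval for `∂_j`).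
[cite: Grafakos2014, Prop. 3.2.6 (8) and Prop. 3.2.7 (3)] [cite: BardosTitiWiedemann2012, Lemma 4] -/
theorem tsum_far_iterate_le (hγ : 0 ≤ P.γ) (hδ₀ : 0 < P.δ₀) (hd : 0 < P.d)
    (a b : ℕ → UnitAddTorus (Fin 2) → ℝ) (has : ∀ j, IsSmooth (a j)) (h0 : a 0 = datum)
    (hb : ∀ j, b j = a j ∘ shearMap 0 1 (amp ⟨P.U j, P.U_periodic j, P.contDiff_U (P.δ_pos hδ₀ hd j)⟩ P.γ))
    (hab : ∀ j, a (j + 1) = b j ∘ shearMap 1 0 (amp ⟨P.U j, P.U_periodic j, P.contDiff_U (P.δ_pos hδ₀ hd j)⟩ P.γ))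
    (n : ℕ) (j : Fin 2) {R : ℝ} (hR : 0 < R) :
    ∑' k : Fin 2 → ℤ, (if R ≤ |((k j : ℤ) : ℝ)| then (1 : ℝ) else 0) * ‖mFourierCoeff (fun x => (a n x : ℂ)) k‖ ^ 2 ≤
      ((1 + P.γ) ^ (2 * n) / R) ^ 2 := by
  have hG : ∀ l x, |partialDeriv l (a 0) x| ≤ 2 * Real.pi := fun l x => by rw [h0]; exact abs_partialDeriv_datum_le l x
  have hD := (abs_partialDeriv_iterate_le P hγ hδ₀ hd a b has hb hab Real.two_pi_pos.le hG n).1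
  refine (tsum_far_le_of_abs_partialDeriv_le (has n) j hR (D := 2 * Real.pi * (1 + P.γ) ^ (2 * n)) (fun x => hD j x)).trans
    (le_of_eq ?_)
  congr 1
  field_simp

/-- **The far channels vanish along the thin schedule**: for shape-free `5 ≤ γ`, `L_min ≥ 1000`, `c > 0` and every `f > 0`,
eventually in `n` both far channels of `a_n` beyond the envelope `R_n = 2c(γ²−3)ⁿ(Γ/ρ₀)ⁿ` are `≤ f`.
[cite: Grafakos2014, Prop. 3.2.6 (8) and Prop. 3.2.7 (3)] -/
theorem eventually_far_iterate_le (hγ : 5 ≤ P.γ) (hγ' : P.γ ≤ 8) (hδ₀ : 0 < P.δ₀) (hd : 0 < P.d) {Lm : ℝ} (hLm : 1000 ≤ Lm)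
    (a b : ℕ → UnitAddTorus (Fin 2) → ℝ) (has : ∀ j, IsSmooth (a j)) (h0 : a 0 = datum)
    (hb : ∀ j, b j = a j ∘ shearMap 0 1 (amp ⟨P.U j, P.U_periodic j, P.contDiff_U (P.δ_pos hδ₀ hd j)⟩ P.γ))
    (hab : ∀ j, a (j + 1) = b j ∘ shearMap 1 0 (amp ⟨P.U j, P.U_periodic j, P.contDiff_U (P.δ_pos hδ₀ hd j)⟩ P.γ))
    {c : ℝ} (hc : 0 < c) {f : ℝ} (hf : 0 < f) :
    ∀ᶠ n : ℕ in atTop, ∀ j : Fin 2,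
      ∑' k : Fin 2 → ℤ, (if 2 * (c * (P.γ ^ 2 - 3) ^ n / ((P.γ ^ 2 - 5 / 2) / (1 + 1 / 250) ^ 2 - 1 / (2 * (1 + 1 / 250) * Lm)) ^ n) *
          ((1 + P.γ) ^ 2 + 1) ^ n ≤ |((k j : ℤ) : ℝ)| then (1 : ℝ) else 0) * ‖mFourierCoeff (fun x => (a n x : ℂ)) k‖ ^ 2 ≤ f := by
  have hγ0 : 0 ≤ P.γ := by linarith
  have hr0 : 0 < P.γ ^ 2 - 3 := by nlinarith
  have hρ0 : 0 < (P.γ ^ 2 - 5 / 2) / (1 + 1 / 250) ^ 2 - 1 / (2 * (1 + 1 / 250) * Lm) := rho_pos hγ hγ' hLm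
  have hΓ0 : 0 < (1 + P.γ) ^ 2 + 1 := by positivity
  set ϑ : ℝ := (1 + P.γ) ^ 2 * ((P.γ ^ 2 - 5 / 2) / (1 + 1 / 250) ^ 2 - 1 / (2 * (1 + 1 / 250) * Lm)) /
    ((P.γ ^ 2 - 3) * ((1 + P.γ) ^ 2 + 1)) with hϑ
  have hϑ0 : 0 ≤ ϑ := by positivity
  have hϑ1 : ϑ < 1 := farRate_lt_one hγ hLm
  have ht : Tendsto (fun n : ℕ => (1 / (2 * c) * ϑ ^ n) ^ 2) atTop (𝓝 ((1 / (2 * c) * 0) ^ 2)) :=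
    ((tendsto_pow_atTop_nhds_zero_of_lt_one hϑ0 hϑ1).const_mul (1 / (2 * c))).pow 2
  rw [mul_zero, zero_pow two_ne_zero] at ht
  filter_upwards [ht.eventually (ge_mem_nhds hf)] with n hn j
  have hR : 0 < 2 * (c * (P.γ ^ 2 - 3) ^ n / ((P.γ ^ 2 - 5 / 2) / (1 + 1 / 250) ^ 2 - 1 / (2 * (1 + 1 / 250) * Lm)) ^ n) *
      ((1 + P.γ) ^ 2 + 1) ^ n := by positivity
  refine (tsum_far_iterate_le P hγ0 hδ₀ hd a b has h0 hb hab n j hR).trans ?_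
  rw [farRatio_eq hc.ne' hr0.ne' hρ0.ne' hΓ0.ne' n]
  have e : (1 + P.γ) ^ 2 * ((P.γ ^ 2 - 5 / 2) / (1 + 1 / 250) ^ 2 - 1 / (2 * (1 + 1 / 250) * Lm)) /
      ((P.γ ^ 2 - 3) * ((1 + P.γ) ^ 2 + 1)) = ϑ := rfl
  rw [e]; exact hn

/-! ## §3 The «frequently» doors of the thin closers -/

/-- **`K1Localised P (γ² − 3)` from a thin first good piece at INFINITELY MANY start phases** («frequently» door of
`…LedgerThinClose.k1Localised_of_thin_firstGoodPiece`): the closer needs ONE start phase beyond its three thresholds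
(scale `≤ 1`, radius `≥ L_min`, budget), so the socket is only needed frequently in `i₀`.
[cite: DEIJ2022, (1.2)–(1.3)] [cite: ElgindiLissMattingly2025, §1.2 and §3.1] -/
theorem k1Localised_of_thin_firstGoodPiece_frequently (hγ : 5 ≤ P.γ) (hγ' : P.γ ≤ 8) (hδ₀ : 0 < P.δ₀)
    (hδ₀' : P.δ₀ ≤ 1 / 4) (hd : P.d = 2) (hN₀ : P.N₀ = 1) (hρN : P.ρN = 2) {Lm : ℝ} (hLm : 1000 ≤ Lm)
    (hE : 0 < Torus.scalarL2Sq datum) {c : ℝ} (hc : 0 < c) {q : ℝ} (hq : 0 ≤ q)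
    (hqE : q < Real.sqrt (Torus.scalarL2Sq datum))
    (hstart : ∃ᶠ i₀ : ℕ in atTop,
      ∀ η : ℝ, 0 < η → ∃ κ₁ : ℝ, 0 < κ₁ ∧ ∀ κ ∈ Ioc (0 : ℝ) κ₁, ∀ w : ℝ → UnitAddTorus (Fin 2) → ℝ,
        FluidPDE.Torus.IsClassicalScalarTransportOn (Ico 0 1) κ P.field w → w 0 = datum →
          Real.sqrt (∑' k : Fin 2 → ℤ, (1 - Real.smoothTransition ((|((k 0 : ℤ) : ℝ)| - c * (P.γ ^ 2 - 3) ^ i₀) /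
            (1 / 250 * (c * (P.γ ^ 2 - 3) ^ i₀))) *
          (1 - Real.smoothTransition ((P.γ * |((k 1 : ℤ) : ℝ)| - 13 / 10 * |((k 0 : ℤ) : ℝ)|) /
            (1 / 20 * (c * (P.γ ^ 2 - 3) ^ i₀)))) *
        ((1 - Real.smoothTransition ((|((k 0 : ℤ) : ℝ)| - 2 * (c * (P.γ ^ 2 - 3) ^ i₀ / ((P.γ ^ 2 - 5 / 2) / (1 + 1 / 250) ^ 2 - 1 / (2 * (1 + 1 / 250) * Lm)) ^ i₀) * ((1 + P.γ) ^ 2 + 1) ^ i₀) /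
            (c * (P.γ ^ 2 - 3) ^ i₀ / (20 * P.γ * (1 + 1 / 250))))) *
          (1 - Real.smoothTransition ((|((k 1 : ℤ) : ℝ)| - 2 * (c * (P.γ ^ 2 - 3) ^ i₀ / ((P.γ ^ 2 - 5 / 2) / (1 + 1 / 250) ^ 2 - 1 / (2 * (1 + 1 / 250) * Lm)) ^ i₀) * ((1 + P.γ) ^ 2 + 1) ^ i₀) /
            (c * (P.γ ^ 2 - 3) ^ i₀ / (20 * P.γ * (1 + 1 / 250))))))) ^ 2 *
            ‖mFourierCoeff (fun x => (w (tStart i₀) x : ℂ)) k‖ ^ 2) ≤ q + η) :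
    K1Localised P (P.γ ^ 2 - 3) := by
  have hr1 : 1 < P.γ ^ 2 - 3 := one_lt_rate hγ
  have hr0 : 0 < P.γ ^ 2 - 3 := by linarith
  have hrρ : P.γ ^ 2 - 3 < ((P.γ ^ 2 - 5 / 2) / (1 + 1 / 250) ^ 2 - 1 / (2 * (1 + 1 / 250) * Lm)) := rate_lt_rho hγ hγ' hLm
  have hρ0 : 0 < ((P.γ ^ 2 - 5 / 2) / (1 + 1 / 250) ^ 2 - 1 / (2 * (1 + 1 / 250) * Lm)) := rho_pos hγ hγ' hLm
  have hr22 : (22 : ℝ) ≤ P.γ ^ 2 - 3 := by nlinarith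
  have hρ16 : 16 < ((P.γ ^ 2 - 5 / 2) / (1 + 1 / 250) ^ 2 - 1 / (2 * (1 + 1 / 250) * Lm)) := by linarith
  obtain ⟨-, hθ1, hθ0⟩ := theta_facts hρ16
  have h1θ : 0 < 1 - Real.sqrt (Real.sqrt (max (16 / ((P.γ ^ 2 - 5 / 2) / (1 + 1 / 250) ^ 2 - 1 / (2 * (1 + 1 / 250) * Lm))) (1 / 2))) := by linarith
  obtain ⟨hϑ0, hϑ1⟩ := thinRate_nonneg_lt_one hγ hγ' hLm
  obtain ⟨Kε, Kζ, hKε, hKζ, hmain⟩ :=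
    highModeConcentration_of_firstGoodPiece P hγ hγ' hδ₀ hδ₀' hd hN₀ hρN hLm hE (B := 1) (fun _ => Real.abs_sin_le_one _)
  -- a start phase at which the scale is `≤ 1`, the radius is `≥ L_min`, the budget holds, AND the socket holds
  have e1 := eventually_thinScale_le_one (c := c) hr0.le hrρ
  have e2 := eventually_le_thinRadius (Lm := Lm) hc hr1
  have e3 := eventually_budget (Kε := Kε / (c * (1 - Real.sqrt (Real.sqrt (max (16 / ((P.γ ^ 2 - 5 / 2) / (1 + 1 / 250) ^ 2 - 1 / (2 * (1 + 1 / 250) * Lm))) (1 / 2))))))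
    (Kζ := Kζ / (c * (1 - Real.sqrt (Real.sqrt (max (16 / ((P.γ ^ 2 - 5 / 2) / (1 + 1 / 250) ^ 2 - 1 / (2 * (1 + 1 / 250) * Lm))) (1 / 2)))))) hq hqE (by positivity) (by positivity) hϑ0 hϑ1
  obtain ⟨i₀, ⟨⟨hi1, hi2⟩, hi3⟩, hi4⟩ := (((e1.and e2).and e3).and_frequently hstart).exists
  have hL0 : 0 < c * (P.γ ^ 2 - 3) ^ i₀ / ((P.γ ^ 2 - 5 / 2) / (1 + 1 / 250) ^ 2 - 1 / (2 * (1 + 1 / 250) * Lm)) ^ i₀ := by positivity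
  have heq : c * (P.γ ^ 2 - 3) ^ i₀ / ((P.γ ^ 2 - 5 / 2) / (1 + 1 / 250) ^ 2 - 1 / (2 * (1 + 1 / 250) * Lm)) ^ i₀ * ((P.γ ^ 2 - 5 / 2) / (1 + 1 / 250) ^ 2 - 1 / (2 * (1 + 1 / 250) * Lm)) ^ i₀ = c * (P.γ ^ 2 - 3) ^ i₀ :=
    div_mul_cancel₀ _ (pow_ne_zero _ hρ0.ne')
  refine k1Localised_of_highModeConcentration P (P.γ ^ 2 - 3)
    (hmain (c * (P.γ ^ 2 - 3) ^ i₀ / ((P.γ ^ 2 - 5 / 2) / (1 + 1 / 250) ^ 2 - 1 / (2 * (1 + 1 / 250) * Lm)) ^ i₀) hL0 hi1 i₀ (by rw [heq]; exact hi2) q hq ?_ ?_)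
  · simp only [heq]
    exact hi4
  · rw [div_thinScale_mul_pow hc.ne' hr0.ne' hρ0.ne' h1θ.ne' i₀, div_thinScale_mul_pow hc.ne' hr0.ne' hρ0.ne' h1θ.ne' i₀]
    exact hi3

/-- **`K1Localised P (γ² − 3)` from a thin bound on the inviscid iterates at INFINITELY MANY phases** («frequently» door
of `…LedgerThinClose.k1Localised_of_thin_iterate_bound`): ONE level `q < ‖datum‖`, ANY `c > 0`, and
`√(Σ μ_n(k)²|𝓕a_n(k)|²) ≤ q` frequently in `n`. [cite: DEIJ2022, (1.2)–(1.3)] [cite: BedrossianCotiZelati2017, §2] -/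
theorem k1Localised_of_thin_iterate_bound_frequently (hγ : 5 ≤ P.γ) (hγ' : P.γ ≤ 8) (hδ₀ : 0 < P.δ₀)
    (hδ₀' : P.δ₀ ≤ 1 / 4) (hd : P.d = 2) (hN₀ : P.N₀ = 1) (hρN : P.ρN = 2) {Lm : ℝ} (hLm : 1000 ≤ Lm)
    (hE : 0 < Torus.scalarL2Sq datum)
    (a b : ℕ → UnitAddTorus (Fin 2) → ℝ) (has : ∀ j, IsSmooth (a j)) (h0 : a 0 = datum)
    (hb : ∀ j, b j = a j ∘ shearMap 0 1 (amp ⟨P.U j, P.U_periodic j, P.contDiff_U (P.δ_pos hδ₀ (by rw [hd]; norm_num) j)⟩ P.γ))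
    (hab : ∀ j, a (j + 1) = b j ∘ shearMap 1 0 (amp ⟨P.U j, P.U_periodic j, P.contDiff_U (P.δ_pos hδ₀ (by rw [hd]; norm_num) j)⟩ P.γ))
    {c : ℝ} (hc : 0 < c) {q : ℝ} (hq : 0 ≤ q) (hqE : q < Real.sqrt (Torus.scalarL2Sq datum))
    (hiter : ∃ᶠ n : ℕ in atTop,
      Real.sqrt (∑' k : Fin 2 → ℤ, (1 - Real.smoothTransition ((|((k 0 : ℤ) : ℝ)| - c * (P.γ ^ 2 - 3) ^ n) /
            (1 / 250 * (c * (P.γ ^ 2 - 3) ^ n))) *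
          (1 - Real.smoothTransition ((P.γ * |((k 1 : ℤ) : ℝ)| - 13 / 10 * |((k 0 : ℤ) : ℝ)|) /
            (1 / 20 * (c * (P.γ ^ 2 - 3) ^ n)))) *
        ((1 - Real.smoothTransition ((|((k 0 : ℤ) : ℝ)| - 2 * (c * (P.γ ^ 2 - 3) ^ n / ((P.γ ^ 2 - 5 / 2) / (1 + 1 / 250) ^ 2 - 1 / (2 * (1 + 1 / 250) * Lm)) ^ n) * ((1 + P.γ) ^ 2 + 1) ^ n) /
            (c * (P.γ ^ 2 - 3) ^ n / (20 * P.γ * (1 + 1 / 250))))) *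
          (1 - Real.smoothTransition ((|((k 1 : ℤ) : ℝ)| - 2 * (c * (P.γ ^ 2 - 3) ^ n / ((P.γ ^ 2 - 5 / 2) / (1 + 1 / 250) ^ 2 - 1 / (2 * (1 + 1 / 250) * Lm)) ^ n) * ((1 + P.γ) ^ 2 + 1) ^ n) /
            (c * (P.γ ^ 2 - 3) ^ n / (20 * P.γ * (1 + 1 / 250))))))) ^ 2 * ‖mFourierCoeff (fun x => (a n x : ℂ)) k‖ ^ 2) ≤ q) :
    K1Localised P (P.γ ^ 2 - 3) := by
  have hγ0 : 0 ≤ P.γ := by linarith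
  have hd0 : 0 < P.d := by rw [hd]; norm_num
  have hE0 : 0 ≤ Torus.scalarL2Sq datum := hE.le
  refine k1Localised_of_thin_firstGoodPiece_frequently P hγ hγ' hδ₀ hδ₀' hd hN₀ hρN hLm hE hc hq hqE ?_
  refine hiter.mono fun i₀ hi η hη => ?_
  -- the enstrophy constant of the first `i₀` phases and the threshold `κ₁(η)`
  set A : ℝ := 2 * Real.pi * Real.sqrt (1 + (1 + P.γ) ^ 2) * (1 + P.γ) ^ (2 * i₀) with hA
  have hA0 : 0 ≤ A := by positivity
  have hT0 : 0 ≤ tStart i₀ := tStart_nonneg i₀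
  set κ₁ : ℝ := η ^ 4 / (A ^ 2 * (2 * tStart i₀ * Torus.scalarL2Sq datum) + 1) with hκ₁
  have hκ₁0 : 0 < κ₁ := by positivity
  refine ⟨κ₁, hκ₁0, fun κ hκ w hw hw0 => ?_⟩
  have h := sqrt_tsum_symbol_sq_datum_le_of_inviscid P hγ0 hδ₀ hd0 a b has h0 hb hab i₀ _
    (fun k => abs_symProdS_le_one P.γ (1 / 250) (1 / 20) (13 / 10) (c * (P.γ ^ 2 - 3) ^ i₀)
      (2 * (c * (P.γ ^ 2 - 3) ^ i₀ / ((P.γ ^ 2 - 5 / 2) / (1 + 1 / 250) ^ 2 - 1 / (2 * (1 + 1 / 250) * Lm)) ^ i₀) * ((1 + P.γ) ^ 2 + 1) ^ i₀)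
      (c * (P.γ ^ 2 - 3) ^ i₀ / (20 * P.γ * (1 + 1 / 250))) (k 0) (k 1))
    (κ₁ := κ₁) hi κ hκ w hw hw0
  refine h.trans (add_le_add le_rfl ?_)
  refine Real.sqrt_le_iff.2 ⟨hη.le, ?_⟩
  exact mul_sqrt_threshold_le (η := η) hA0 hT0 hE0

end Cascade

end Summit.AnomalousDissipation.AnomalousDissipation.Theorems.SawtoothPulseCascade.K1Ledger.From
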